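import Literature.MathematicalPhysics.QuantumFieldTheory.Balaban1983to89.B5Strip145Leaves

/-!
# `Balaban1983to89.B5Strip145Analytic` — periodicity, joint holomorphy and the packaged strip data of the multiplier (1.45)

T. Bałaban, *Propagators and renormalization transformations for lattice gauge theories. I*,
Commun. Math. Phys. **95**, 17–40 (1984) [Balaban1984PropagatorsI] (cell paper B5), p. 26 [PDF 10] (1.45) and p. 38 [PDF 22];
T. Bałaban, *Regularity and decay of lattice Green's functions*, Commun. Math. Phys. **89**, 571–597 (1983)
[Balaban1983RegularityDecay] (cell paper B4 = B5's reference [2]), p. 586 [PDF 16], the three sentences after (2.51).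

CITATION HEADER (lean-in-tree rule 2026-08-18).  This module is a SUPPLEMENT, not a quotation.  B4 says of the integrand of
(2.49) (p. 586 [PDF 16], verbatim): *"The expression is a function of p′ and can be extended as an analytic function to some
neighbourhood of [−π, π]^d. It is more troublesome, but equally elementary, to prove that this neighbourhood can be chosen
independently of j and that the expression is bounded also in this neighbourhood. Shifting the domain of integration in
(2.49) into a complex domain in the direction of the vector x′ − y, we can bound the left hand side of (2.49) by a constant
depending on α multiplied by the exponential factor e^{−δ₀|x′−y|} = e^{−δ₀dist({x,x′},y)}."*  B5 imports the method for the
kernel of `(Q′G′²Q′*)⁻¹` (p. 38 [PDF 22], the sentence before (1.126), verbatim): *"They follow from the representation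
P = G′Q′*(Q′G′²Q′*)⁻¹Q′G′, from Lemma 2.4 of [2], and the representation (1.45) and the analyticity method of proving an
exponential decay (see the proof of Lemma 2.4 in [2])"*.  "Shifting the domain of integration" for a unit-lattice kernel
`K(y) = (2π)^{-d} ∫_{[−π,π]^d} G(p′) e^{ip′y} dp′` to `p′ + iq`, `|q_μ| ≤ κ`, uses — besides a bound on `|G|` in the strip, which
for `G = (Q′G′²Q′*)⁻¹(p′) = E²/𝒩 = 1/mReg` is `B5Strip145Leaves.uniformStrip145_holds` — two facts about `G` that neither paper
states: (E1) `G` is `2π`-PERIODIC in each `p′_μ` (so the two vertical sides of the shifted rectangle cancel), and (E2) `G` is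
continuous on the closed strip and HOLOMORPHIC there (so Cauchy's theorem applies).  For the regrouped symbols of the audit
(`E = B4Strip.E n a 0`, `𝒩 = B5Strip145.Ncal n`, `mReg = 𝒩/E²`) neither is a tautology: `E` and `𝒩` carry the NON-periodic
factor `Δ^ξ(p′)` (period `2πn`, not `2π`) and are only quasi-periodic (`E_tr`, `Ncal_tr` below), the averaging factor
`uFactor n 0` is filled with the value `1` at `0` and is not globally periodic, and the earlier modules proved holomorphy
only along coordinate SLICES.  This file proves (E1) and (E2) for `1/mReg` as theorems about the symbols and packages them
with the bound; the shift itself (Cauchy/Fubini and the decay estimate — census node G-B4-S3, another seat's module) is NOT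
performed here, nor is the finite-torus (discrete `p′`) version, nor the B4 integrand (2.48) (which needs the multiplier sums
(2.51) and is only quasi-periodic once `e^{ip′x}`, `x ∈ ξℤ^d`, is factored out).

WHAT THIS FILE DOES (0 sorry, no axiom beyond Lean's three, no `opaque`; nothing cited is used as a hypothesis; the sibling
modules `B4Strip`, `B4StripCauchy`, `B5Strip145`, `B5Strip145Leaves` are IMPORTED, untouched):
* §1 the residue index shift `σ_μ : k ↦ k + e_μ (mod n)` on `{0,…,n−1}^d` (`sigma`, a bijection `sigmaEquiv`) and the
  one-variable identities: `S₁` is `2π`-periodic, `S_ξ` is `2πn`-periodic (`Sxi_add_nat_mul`, `Sxi_shift_mod`), and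
  `uFactor_add_two_pi : u_n(j; z + 2π) = u_n(j+1 mod n; z)` for `z ∉ {0, −2π}`;
* §2 the translate `tr p μ = p + 2π e_μ` and the relabelling `l ↦ l + 2π e_μ`: `U_tr : U_k(p + 2πe_μ) = U_{σ_μ k}(p)`,
  `DeltaXi_shift_tr : Δ^ξ_k(p + 2πe_μ) = Δ^ξ_{σ_μ k}(p)`; the periodic factors `Bfac = 1 + aΣ_l U_l/Δ^ξ_l` (`E = Δ^ξ·B`,
  `B4Strip.E_eq_mul`) and `Yfac = Σ_l U_l/Δ_l²` (`𝒩 = Δ²·Y`, `B5Strip145.Ncal_eq_mul`) are periodic (`Bfac_tr`, `Yfac_tr`, by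
  `Equiv.sum_comp` over `σ_μ`); the SHIFT LAWS `E_tr : E(p+2πe_μ)·Δ^ξ(p) = Δ^ξ(p+2πe_μ)·E(p)` (all `m²`),
  `Ncal_tr : 𝒩(p+2πe_μ)·Δ(p)² = Δ(p+2πe_μ)²·𝒩(p)`; hence **`mReg_tr : mReg(p + 2πe_μ) = mReg(p)`** wherever `p_μ ∉ {0,−2π}` and
  `Δ(p)`, `Δ(p+2πe_μ)` are nonzero;
* §3 the strip sides: `re_DeltaXi_pos_of_edge` (`Re Δ^ξ ≥ 4 − (25/16)dκ² > 0` at a point with all `|Im q_ν| ≤ κ ≤ 1`,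
  `dκ² ≤ 1/16`, and some `|Re q_μ| = π`, from `B4StripCauchy.re_Sxi_ge` and Jordan), and **`mReg_periodic_side`**: for
  `p ∈ Strip d κ` with `Re p_μ = −π`, `mReg(p + 2πe_μ) = mReg(p)` — (E1);
* §4 JOINT holomorphy on the fat region `F_r` (`r ≤ 1/4`, `d r² ≤ 1/16`): `differentiableAt_E` (all `m² ≥ 0`, strengthening
  `B4StripCauchy.differentiableAt_E_slice`), `differentiableAt_Ncal`, `differentiableAt_mReg` (`E ≠ 0`),
  `differentiableAt_mReg_inv` (`E, mReg ≠ 0`) and its slice form `differentiableAt_mReg_inv_slice` — (E2);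
* §5 **`inverse145_analytic_inputs (ha : 0 < a₋)`**: `∃ κ ∈ (0, r], M > 0, ∀ n ≥ 1, ∀ a ∈ [a₋, a₊]`: on `Strip d κ`,
  `E ≠ 0 ∧ mReg ≠ 0`, `p ↦ 1/mReg` is continuous, holomorphic at every point, periodic across the sides, and `‖1/mReg‖ ≤ M`
  (`κ = min κ₁₄₅ r`, `M = 1/c` from `uniformStrip145_holds`).

Value = kernel certificate of symbol facts used silently by the printed "shifting the domain of integration" (B4 p. 586 ←
B5 p. 38); NOT summit progress.  Unit b2b-balaban-b04-g3 (B04 cell, gen 3; B4 → B5 edge); staged byte-identically under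
`HOME/lean/BalabanYm4/`.
-/

namespace Literature.MathematicalPhysics.QuantumFieldTheory.Balaban1983to89.B5Strip145Analytic

open Complex Finset Metric
open Literature.MathematicalPhysics.QuantumFieldTheory.Balaban1983to89.B4Strip
open Literature.MathematicalPhysics.QuantumFieldTheory.Balaban1983to89.B4StripCauchy
open Literature.MathematicalPhysics.QuantumFieldTheory.Balaban1983to89.B5Strip145
open Literature.MathematicalPhysics.QuantumFieldTheory.Balaban1983to89.B5Strip145Leaves

noncomputable section

variable {d : ℕ}

/-! ### §1 The residue index shift and the one-variable `2π`-shift identities -/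

/-- the residue index shift `σ_μ : k ↦ k + e_μ (mod n)` on `{0,…,n−1}^d` (the relabelling `l ↦ l + 2π e_μ` of
`l ∈ Λ̃`, (2.44)). [folklore] -/
def sigma (n : ℕ) [NeZero n] (μ : Fin d) (k : Fin d → Fin n) : Fin d → Fin n :=
  Function.update k μ (k μ + 1)

/-- `σ_μ` is a bijection (inverse `k ↦ k − e_μ`). [folklore] -/
def sigmaEquiv (n : ℕ) [NeZero n] (μ : Fin d) : (Fin d → Fin n) ≃ (Fin d → Fin n) where
  toFun := sigma n μ
  invFun k := Function.update k μ (k μ - 1)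
  left_inv k := by
    unfold sigma
    simp only [Function.update_self, Function.update_idem, add_sub_cancel_right, Function.update_eq_self]
  right_inv k := by
    unfold sigma
    simp only [Function.update_self, Function.update_idem, sub_add_cancel, Function.update_eq_self]

/-- `σ_μ k` agrees with `k` off the coordinate `μ`. [folklore] -/
theorem sigma_apply_of_ne (n : ℕ) [NeZero n] {μ ν : Fin d} (h : ν ≠ μ) (k : Fin d → Fin n) :
    sigma n μ k ν = k ν := by
  simp [sigma, Function.update_of_ne h]

/-- `(σ_μ k)_μ = k_μ + 1 (mod n)`. [folklore] -/
theorem sigma_apply_self (n : ℕ) [NeZero n] (μ : Fin d) (k : Fin d → Fin n) :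
    sigma n μ k μ = k μ + 1 := by
  simp [sigma]

/-- the value of `k_μ + 1 (mod n)` as a natural number. [folklore] -/
theorem val_add_one_eq_mod (n : ℕ) [NeZero n] (j : Fin n) : ((j + 1 : Fin n) : ℕ) = ((j : ℕ) + 1) % n := by
  rw [Fin.val_add, Fin.val_one', Nat.add_mod_mod]

/-- `S₁` is `2π`-periodic. [folklore] -/
theorem S1_add_two_pi (z : ℂ) : S1 (z + 2 * Real.pi) = S1 z := by
  simp [S1, Complex.cos_add_two_pi]

/-- `S_ξ` is `2πn`-periodic: `S_ξ(z + 2π(a + n b)) = S_ξ(z + 2πa)`. [folklore] -/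
theorem Sxi_add_nat_mul (n : ℕ) (hn : n ≠ 0) (z : ℂ) (a b : ℕ) :
    Sxi n (z + 2 * Real.pi * ((a + n * b : ℕ) : ℂ)) = Sxi n (z + 2 * Real.pi * (a : ℂ)) := by
  have hn' : (n : ℂ) ≠ 0 := Nat.cast_ne_zero.mpr hn
  unfold Sxi
  have e : (z + 2 * Real.pi * ((a + n * b : ℕ) : ℂ)) / n = (z + 2 * Real.pi * (a : ℂ)) / n + b * (2 * Real.pi) := by
    push_cast
    field_simp
    ring
  rw [e, Complex.cos_add_nat_mul_two_pi]

/-- reduction of the residue modulo `n` inside `S_ξ`: `S_ξ(z + 2π(a mod n)) = S_ξ(z + 2πa)`. [folklore] -/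
theorem Sxi_shift_mod (n : ℕ) (hn : n ≠ 0) (z : ℂ) (a : ℕ) :
    Sxi n (z + 2 * Real.pi * ((a % n : ℕ) : ℂ)) = Sxi n (z + 2 * Real.pi * (a : ℂ)) := by
  conv_rhs => rw [← Nat.mod_add_div a n]
  exact (Sxi_add_nat_mul n hn z (a % n) (a / n)).symm

/-- off `z = 0` both branches of `uFactor` are the quotient `S₁(z)/S_ξ(z + 2πj)`. [folklore] -/
theorem uFactor_eq_div (n j : ℕ) {z : ℂ} (hz : z ≠ 0) :
    uFactor n j z = S1 z / Sxi n (z + 2 * Real.pi * (j : ℂ)) := by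
  unfold uFactor
  split_ifs with hj
  · simp [hj]
  · rfl

/-- THE ONE-VARIABLE SHIFT: `u_n(j; z + 2π) = u_n(j+1 mod n; z)` for `z ∉ {0, −2π}`. [folklore] -/
theorem uFactor_add_two_pi (n : ℕ) [NeZero n] (j : Fin n) {z : ℂ} (hz : z ≠ 0)
    (hz' : z + 2 * Real.pi ≠ 0) :
    uFactor n (j : ℕ) (z + 2 * Real.pi) = uFactor n ((j + 1 : Fin n) : ℕ) z := by
  have hn : n ≠ 0 := NeZero.ne n
  rw [uFactor_eq_div n _ hz', uFactor_eq_div n _ hz, val_add_one_eq_mod, Sxi_shift_mod n hn,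
    S1_add_two_pi]
  congr 1
  push_cast
  ring_nf

/-- `S_ξ(z + 2π + 2πj) = S_ξ(z + 2π(j+1 mod n))`. [folklore] -/
theorem Sxi_add_two_pi_shift (n : ℕ) [NeZero n] (j : Fin n) (z : ℂ) :
    Sxi n (z + 2 * Real.pi + 2 * Real.pi * (j : ℂ)) = Sxi n (z + 2 * Real.pi * (((j + 1 : Fin n) : ℕ) : ℂ)) := by
  have hn : n ≠ 0 := NeZero.ne n
  rw [val_add_one_eq_mod, Sxi_shift_mod n hn]
  congr 1
  push_cast
  ring

/-! ### §2 `2π`-shift identities for the momentum symbols -/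

/-- the `2π`-translate of `p` in the coordinate `μ`. [folklore] -/
def tr (p : Fin d → ℂ) (μ : Fin d) : Fin d → ℂ := Function.update p μ (p μ + 2 * Real.pi)

/-- unfolding lemma for consumers. [folklore] -/
theorem tr_def (p : Fin d → ℂ) (μ : Fin d) : tr p μ = Function.update p μ (p μ + 2 * Real.pi) := rfl

/-- `tr p μ` agrees with `p` off `μ`. [folklore] -/
theorem tr_apply_of_ne {μ ν : Fin d} (h : ν ≠ μ) (p : Fin d → ℂ) : tr p μ ν = p ν := by
  simp [tr, Function.update_of_ne h]

/-- `(tr p μ)_μ = p_μ + 2π`. [folklore] -/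
theorem tr_apply_self (μ : Fin d) (p : Fin d → ℂ) : tr p μ μ = p μ + 2 * Real.pi := by
  simp [tr]

/-- `U_k(p + 2π e_μ) = U_{σ_μ k}(p)` for `p_μ ∉ {0, −2π}` (the block-averaging symbol relabels under `2π`-shifts).
[folklore] -/
theorem U_tr (n : ℕ) [NeZero n] (k : Fin d → Fin n) (p : Fin d → ℂ) (μ : Fin d) (hz : p μ ≠ 0)
    (hz' : p μ + 2 * Real.pi ≠ 0) : U n k (tr p μ) = U n (sigma n μ k) p := by
  unfold U
  refine Finset.prod_congr rfl (fun ν _ => ?_)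
  by_cases h : ν = μ
  · subst h
    rw [tr_apply_self, sigma_apply_self]
    exact uFactor_add_two_pi n (k ν) hz hz'
  · rw [tr_apply_of_ne h, sigma_apply_of_ne n h]

/-- `Δ^ξ_k(p + 2π e_μ) = Δ^ξ_{σ_μ k}(p)` (no side condition: `S_ξ` is entire and `2πn`-periodic). [folklore] -/
theorem DeltaXi_shift_tr (n : ℕ) [NeZero n] (m2 : ℝ) (k : Fin d → Fin n) (p : Fin d → ℂ) (μ : Fin d) :
    DeltaXi n m2 (shift n k (tr p μ)) = DeltaXi n m2 (shift n (sigma n μ k) p) := by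
  unfold DeltaXi shift
  congr 1
  refine Finset.sum_congr rfl (fun ν _ => ?_)
  by_cases h : ν = μ
  · subst h
    rw [tr_apply_self, sigma_apply_self]
    exact Sxi_add_two_pi_shift n (k ν) (p ν)
  · rw [tr_apply_of_ne h, sigma_apply_of_ne n h]

/-- `Δ^ξ(p + 2π e_μ) = Δ^ξ_{σ_μ 0}(p)`. [folklore] -/
theorem DeltaXi_tr (n : ℕ) [NeZero n] (m2 : ℝ) (p : Fin d → ℂ) (μ : Fin d) :
    DeltaXi n m2 (tr p μ) = DeltaXi n m2 (shift n (sigma n μ (fun _ => 0)) p) := by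
  rw [← DeltaXi_shift_tr n m2 (fun _ => 0) p μ, shift_zero]

/-- the periodic factor `B = 1 + a Σ_l |u(p′+l)|²/Δ^ξ(p′+l)` of the regrouping `E = Δ^ξ · B` (`B4Strip.E_eq_mul`).
[folklore] -/
def Bfac (n : ℕ) [NeZero n] (a m2 : ℝ) (p : Fin d → ℂ) : ℂ :=
  1 + a * ∑ k : Fin d → Fin n, U n k p / DeltaXi n m2 (shift n k p)

/-- the periodic factor `Y = Σ_l |u(p′+l)|²/Δ²(p′+l)` of the regrouping `𝒩 = Δ² · Y` (`B5Strip145.Ncal_eq_mul`).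
[folklore] -/
def Yfac (n : ℕ) [NeZero n] (p : Fin d → ℂ) : ℂ :=
  ∑ k : Fin d → Fin n, U n k p / (DeltaXi n 0 (shift n k p)) ^ 2

/-- `B` is `2π`-periodic in each coordinate (off `p_μ ∈ {0, −2π}`): relabel `l ↦ l + 2π e_μ`. [folklore] -/
theorem Bfac_tr (n : ℕ) [NeZero n] (a m2 : ℝ) (p : Fin d → ℂ) (μ : Fin d) (hz : p μ ≠ 0)
    (hz' : p μ + 2 * Real.pi ≠ 0) : Bfac n a m2 (tr p μ) = Bfac n a m2 p := by
  unfold Bfac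
  congr 2
  simp_rw [U_tr n _ p μ hz hz', DeltaXi_shift_tr n m2 _ p μ]
  exact Equiv.sum_comp (sigmaEquiv n μ) (fun k => U n k p / DeltaXi n m2 (shift n k p))

/-- `Y` is `2π`-periodic in each coordinate (off `p_μ ∈ {0, −2π}`). [folklore] -/
theorem Yfac_tr (n : ℕ) [NeZero n] (p : Fin d → ℂ) (μ : Fin d) (hz : p μ ≠ 0)
    (hz' : p μ + 2 * Real.pi ≠ 0) : Yfac n (tr p μ) = Yfac n p := by
  unfold Yfac
  simp_rw [U_tr n _ p μ hz hz', DeltaXi_shift_tr n 0 _ p μ]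
  exact Equiv.sum_comp (sigmaEquiv n μ) (fun k => U n k p / (DeltaXi n 0 (shift n k p)) ^ 2)

/-- `E = Δ^ξ · B` where `Δ^ξ ≠ 0` (`B4Strip.E_eq_mul`, renamed). [folklore] -/
theorem E_eq_DeltaXi_mul_Bfac (n : ℕ) [NeZero n] (a m2 : ℝ) (p : Fin d → ℂ) (h : DeltaXi n m2 p ≠ 0) :
    E n a m2 p = DeltaXi n m2 p * Bfac n a m2 p := E_eq_mul n a m2 p h

/-- `𝒩 = Δ² · Y` where `Δ ≠ 0` (`B5Strip145.Ncal_eq_mul`, renamed). [folklore] -/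
theorem Ncal_eq_DeltaXi_sq_mul_Yfac (n : ℕ) [NeZero n] (p : Fin d → ℂ) (h : DeltaXi n 0 p ≠ 0) :
    Ncal n p = (DeltaXi n 0 p) ^ 2 * Yfac n p := Ncal_eq_mul n p h

/-- THE SHIFT LAW OF `E`: `E(p + 2π e_μ) · Δ^ξ(p) = Δ^ξ(p + 2π e_μ) · E(p)` where both `Δ^ξ` are nonzero
(`E` itself is not periodic; `E/Δ^ξ = B` is). [folklore] -/
theorem E_tr (n : ℕ) [NeZero n] (a m2 : ℝ) (p : Fin d → ℂ) (μ : Fin d) (hz : p μ ≠ 0)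
    (hz' : p μ + 2 * Real.pi ≠ 0) (h0 : DeltaXi n m2 p ≠ 0) (h1 : DeltaXi n m2 (tr p μ) ≠ 0) :
    E n a m2 (tr p μ) * DeltaXi n m2 p = DeltaXi n m2 (tr p μ) * E n a m2 p := by
  rw [E_eq_DeltaXi_mul_Bfac n a m2 _ h1, E_eq_DeltaXi_mul_Bfac n a m2 _ h0, Bfac_tr n a m2 p μ hz hz']
  ring

/-- THE SHIFT LAW OF `𝒩`: `𝒩(p + 2π e_μ) · Δ(p)² = Δ(p + 2π e_μ)² · 𝒩(p)`. [folklore] -/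
theorem Ncal_tr (n : ℕ) [NeZero n] (p : Fin d → ℂ) (μ : Fin d) (hz : p μ ≠ 0)
    (hz' : p μ + 2 * Real.pi ≠ 0) (h0 : DeltaXi n 0 p ≠ 0) (h1 : DeltaXi n 0 (tr p μ) ≠ 0) :
    Ncal n (tr p μ) * (DeltaXi n 0 p) ^ 2 = (DeltaXi n 0 (tr p μ)) ^ 2 * Ncal n p := by
  rw [Ncal_eq_DeltaXi_sq_mul_Yfac n _ h1, Ncal_eq_DeltaXi_sq_mul_Yfac n _ h0, Yfac_tr n p μ hz hz']
  ring

/-- **`2π`-PERIODICITY OF THE MULTIPLIER (1.45)**: `mReg(p + 2π e_μ) = mReg(p)` (`mReg = 𝒩/E²`) whenever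
`p_μ ∉ {0, −2π}` and `Δ^ξ(p)`, `Δ^ξ(p + 2π e_μ)` are nonzero — as it must be for a unit-lattice Fourier multiplier;
the regrouped `𝒩`, `E` are individually only quasi-periodic (`Ncal_tr`, `E_tr`). [folklore] -/
theorem mReg_tr (n : ℕ) [NeZero n] (a : ℝ) (p : Fin d → ℂ) (μ : Fin d) (hz : p μ ≠ 0)
    (hz' : p μ + 2 * Real.pi ≠ 0) (h0 : DeltaXi n 0 p ≠ 0) (h1 : DeltaXi n 0 (tr p μ) ≠ 0) :
    mReg n a (tr p μ) = mReg n a p := by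
  have hE := E_tr n a 0 p μ hz hz' h0 h1
  have hN := Ncal_tr n p μ hz hz' h0 h1
  unfold mReg
  have eE : E n a 0 (tr p μ) = DeltaXi n 0 (tr p μ) * E n a 0 p / DeltaXi n 0 p := by
    rw [eq_div_iff h0, hE]
  have eN : Ncal n (tr p μ) = (DeltaXi n 0 (tr p μ)) ^ 2 * Ncal n p / (DeltaXi n 0 p) ^ 2 := by
    rw [eq_div_iff (pow_ne_zero 2 h0), hN]
  rw [eE, eN]
  by_cases hEp : E n a 0 p = 0
  · simp [hEp]
  · field_simp


/-! ### §3 The strip sides: non-vanishing of `Δ^ξ` and periodicity of the multiplier -/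

/-- `4 ≤ 4n² sin²(x/2n)` for `|x| = π`, `n ≥ 1` (Jordan). [folklore] -/
theorem four_le_scaled_sin_sq (n : ℕ) (hn : 1 ≤ n) {x : ℝ} (hx : |x| = Real.pi) :
    4 ≤ 4 * (n : ℝ) ^ 2 * Real.sin (x / (2 * n)) ^ 2 := by
  have hnr : (1 : ℝ) ≤ n := by exact_mod_cast hn
  have hπ := Real.pi_pos
  have hu : |x / (2 * n)| ≤ Real.pi / 2 := by
    rw [abs_div, hx, abs_of_pos (by positivity : (0 : ℝ) < 2 * n),
      div_le_iff₀ (by positivity : (0 : ℝ) < 2 * n)]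
    nlinarith
  have hj := jordan_sq hu
  have hx2 : x ^ 2 = Real.pi ^ 2 := by rw [← sq_abs, hx]
  have e : 4 * (n : ℝ) ^ 2 * (4 / Real.pi ^ 2 * (x / (2 * n)) ^ 2) = 4 * x ^ 2 / Real.pi ^ 2 := by
    field_simp
    ring
  have e4 : 4 * x ^ 2 / Real.pi ^ 2 = 4 := by rw [hx2]; field_simp
  have := mul_le_mul_of_nonneg_left hj (by positivity : (0 : ℝ) ≤ 4 * (n : ℝ) ^ 2)
  rw [e, e4] at this
  exact this

/-- `Re (Δ^ξ+m²)(q) > 0` at every point `q` with `|Im q_ν| ≤ κ` for all `ν` (`κ ≤ 1`, `d κ² ≤ 1/16`) one of whose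
coordinates sits on a side of the Brillouin zone, `|Re q_μ| = π`: that coordinate contributes `≥ 4 − (25/16)κ²`, every
other one `≥ −(25/16)κ²` (`B4StripCauchy.re_Sxi_ge`). [folklore] -/
theorem re_DeltaXi_pos_of_edge (n : ℕ) [NeZero n] (m2 : ℝ) (hm : 0 ≤ m2) {κ : ℝ} (hκ1 : κ ≤ 1)
    (hdκ : (d : ℝ) * κ ^ 2 ≤ 1 / 16) {q : Fin d → ℂ} (hIm : ∀ ν, |(q ν).im| ≤ κ) (μ : Fin d)
    (hμ : |(q μ).re| = Real.pi) : 0 < (DeltaXi n m2 q).re := by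
  have hn : 1 ≤ n := Nat.one_le_iff_ne_zero.mpr (NeZero.ne n)
  have hre : (DeltaXi n m2 q).re = ∑ ν, (Sxi n (q ν)).re + m2 := by
    simp [DeltaXi, Complex.re_sum]
  have h1 : ∀ ν, 4 * (n : ℝ) ^ 2 * Real.sin ((q ν).re / (2 * n)) ^ 2 - 25 / 16 * (q ν).im ^ 2
      ≤ (Sxi n (q ν)).re := fun ν => re_Sxi_ge n hn (q ν) ((hIm ν).trans hκ1)
  have h2 : ∀ ν, (q ν).im ^ 2 ≤ κ ^ 2 := fun ν => by
    have h := hIm ν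
    have hk : 0 ≤ κ := (abs_nonneg _).trans h
    rw [← sq_abs]
    exact pow_le_pow_left₀ (abs_nonneg _) h 2
  have hsum : ∑ ν, (4 * (n : ℝ) ^ 2 * Real.sin ((q ν).re / (2 * n)) ^ 2 - 25 / 16 * κ ^ 2)
      ≤ ∑ ν, (Sxi n (q ν)).re := by
    apply Finset.sum_le_sum
    intro ν _
    have := h1 ν
    have := h2 ν
    nlinarith
  have hsingle : 4 * (n : ℝ) ^ 2 * Real.sin ((q μ).re / (2 * n)) ^ 2
      ≤ ∑ ν, 4 * (n : ℝ) ^ 2 * Real.sin ((q ν).re / (2 * n)) ^ 2 :=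
    Finset.single_le_sum (f := fun ν => 4 * (n : ℝ) ^ 2 * Real.sin ((q ν).re / (2 * n)) ^ 2)
      (fun ν _ => by positivity) (Finset.mem_univ μ)
  have h4 := four_le_scaled_sin_sq n hn hμ
  rw [Finset.sum_sub_distrib, Finset.sum_const, Finset.card_univ, Fintype.card_fin, nsmul_eq_mul] at hsum
  rw [hre]
  nlinarith

/-- the `2π`-translate does not move imaginary parts. [folklore] -/
theorem tr_im (p : Fin d → ℂ) (μ ν : Fin d) : (tr p μ ν).im = (p ν).im := by
  by_cases h : ν = μ
  · subst h
    rw [tr_apply_self]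
    simp
  · rw [tr_apply_of_ne h]

/-- real part of the translated coordinate. [folklore] -/
theorem tr_re_self (p : Fin d → ℂ) (μ : Fin d) : (tr p μ μ).re = (p μ).re + 2 * Real.pi := by
  rw [tr_apply_self]
  simp

/-- **PERIODICITY OF (1.45) ACROSS THE STRIP SIDES.**  For `p` in the strip `|Re p_ν| ≤ π`, `|Im p_ν| ≤ κ`
(`κ ≤ 1`, `d κ² ≤ 1/16`) with `Re p_μ = −π`:  `mReg(p + 2π e_μ) = mReg(p)` — the side identification a contour
shift in the coordinate `μ` uses (the two vertical sides of the rectangle cancel).  All four side conditions of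
`mReg_tr` hold there: `p_μ ≠ 0`, `p_μ + 2π ≠ 0`, and `Re Δ^ξ > 0` at `p` and at `p + 2π e_μ` (`re_DeltaXi_pos_of_edge`).
[folklore] -/
theorem mReg_periodic_side (n : ℕ) [NeZero n] (a : ℝ) {κ : ℝ} (hκ1 : κ ≤ 1)
    (hdκ : (d : ℝ) * κ ^ 2 ≤ 1 / 16) {p : Fin d → ℂ} (hp : p ∈ Strip d κ) (μ : Fin d)
    (hre : (p μ).re = -Real.pi) : mReg n a (tr p μ) = mReg n a p := by
  have hπ := Real.pi_pos
  have hz : p μ ≠ 0 := by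
    intro h; rw [h, Complex.zero_re] at hre; linarith
  have hz' : p μ + 2 * Real.pi ≠ 0 := by
    intro h
    have := congrArg Complex.re h
    rw [← tr_apply_self, tr_re_self, hre, Complex.zero_re] at this
    linarith
  have h0 : DeltaXi n 0 p ≠ 0 := by
    intro h
    have := re_DeltaXi_pos_of_edge n 0 le_rfl hκ1 hdκ (fun ν => (hp ν).2) μ
      (by rw [hre, abs_neg, abs_of_pos hπ])
    rw [h, Complex.zero_re] at this
    linarith
  have h1 : DeltaXi n 0 (tr p μ) ≠ 0 := by
    intro h
    have := re_DeltaXi_pos_of_edge n 0 le_rfl hκ1 hdκ (q := tr p μ)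
      (fun ν => by rw [tr_im]; exact (hp ν).2) μ (by rw [tr_re_self, hre]; ring_nf; exact abs_of_pos hπ)
    rw [h, Complex.zero_re] at this
    linarith
  exact mReg_tr n a p μ hz hz' h0 h1

/-- the strip half-widths this file works with: `0 ≤ κ ≤ r = 1/(4(d+1))` gives `κ ≤ 1` and `d κ² ≤ 1/16`. [folklore] -/
theorem kappa_small {κ : ℝ} (hκ0 : 0 ≤ κ) (hκ : κ ≤ rOf d) : κ ≤ 1 ∧ (d : ℝ) * κ ^ 2 ≤ 1 / 16 := by
  have h1 := rOf_le d
  have h2 := d_mul_rOf_sq_le d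
  refine ⟨by linarith, ?_⟩
  have : κ ^ 2 ≤ rOf d ^ 2 := pow_le_pow_left₀ hκ0 hκ 2
  have hd : (0 : ℝ) ≤ d := Nat.cast_nonneg d
  nlinarith

/-! ### §4 Joint holomorphy of `E`, `𝒩`, `mReg` on the fat region -/

/-- finite products of functions holomorphic at a point of `ℂ^d` are holomorphic there. [folklore] -/
theorem dAt_finset_prod {F : Type*} [NormedAddCommGroup F] [NormedSpace ℂ F] {ι : Type*} (s : Finset ι)
    (g : ι → F → ℂ) (x : F) (h : ∀ i ∈ s, DifferentiableAt ℂ (g i) x) :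
    DifferentiableAt ℂ (fun y => ∏ i ∈ s, g i y) x := by
  classical
  induction s using Finset.induction_on with
  | empty => simp
  | insert a s ha ih =>
    simp only [Finset.prod_insert ha]
    exact (h a (Finset.mem_insert_self a s)).mul (ih (fun i hi => h i (Finset.mem_insert_of_mem hi)))

/-- quotients of functions holomorphic at a point of `ℂ^d` (denominator nonzero) are holomorphic there. [folklore] -/
theorem dAt_div {F : Type*} [NormedAddCommGroup F] [NormedSpace ℂ F] {c e : F → ℂ} {x : F}
    (hc : DifferentiableAt ℂ c x) (he : DifferentiableAt ℂ e x) (hx : e x ≠ 0) :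
    DifferentiableAt ℂ (fun y => c y / e y) x := by
  have h : (fun y => c y / e y) = fun y => c y * (e y)⁻¹ := by
    funext y
    rw [div_eq_mul_inv]
  rw [h]
  exact hc.mul (he.inv hx)

/-- `p ↦ Δ^ξ_k(p) = (Δ^ξ+m²)(p + 2πk)` is holomorphic on `ℂ^d` (jointly). [folklore] -/
theorem differentiableAt_DeltaXi_shift (n : ℕ) (m2 : ℝ) (k : Fin d → Fin n) (q : Fin d → ℂ) :
    DifferentiableAt ℂ (fun p : Fin d → ℂ => DeltaXi n m2 (shift n k p)) q := by
  simp only [DeltaXi, shift]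
  apply DifferentiableAt.add_const
  apply DifferentiableAt.fun_sum
  intro ν _
  exact ((differentiable_Sxi n) _).comp q ((differentiableAt_apply ν q).add_const _)

/-- `p ↦ (Δ^ξ+m²)(p)` is holomorphic on `ℂ^d`. [folklore] -/
theorem differentiableAt_DeltaXi (n : ℕ) [NeZero n] (m2 : ℝ) (q : Fin d → ℂ) :
    DifferentiableAt ℂ (fun p : Fin d → ℂ => DeltaXi n m2 p) q := by
  have := differentiableAt_DeltaXi_shift n m2 (fun _ => (0 : Fin n)) q
  simp only [shift_zero] at this
  exact this

/-- `p ↦ U_k(p)` is holomorphic (jointly) at every point of the fat region `F_r`, `r ≤ 1/4`. [folklore] -/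
theorem differentiableAt_U (n : ℕ) [NeZero n] {r : ℝ} (hr : r ≤ 1 / 4) {q : Fin d → ℂ} (hq : q ∈ Fat d r)
    (k : Fin d → Fin n) : DifferentiableAt ℂ (fun p : Fin d → ℂ => U n k p) q := by
  have hn : 1 ≤ n := Nat.one_le_iff_ne_zero.mpr (NeZero.ne n)
  have hπ := Real.pi_gt_three
  simp only [U]
  refine dAt_finset_prod _ _ _ (fun ν _ => ?_)
  have hF : DifferentiableAt ℂ (uFactor n (k ν : ℕ)) (q ν) := by
    by_cases hk : (k ν : ℕ) = 0
    · rw [hk]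
      exact differentiableAt_uFactor_zero n hn (by linarith [(hq ν).1, hr])
    · exact differentiableAt_uFactor_ne n _ hk
        (Sxi_shift_ne_zero n _ (Nat.one_le_iff_ne_zero.mpr hk) (k ν).isLt hr (hq ν).1)
  exact hF.comp q (differentiableAt_apply (𝕜 := ℂ) ν q)

/-- **`E` is holomorphic (jointly in `p ∈ ℂ^d`) at every point of the fat region** (`r ≤ 1/4`, `d r² ≤ 1/16`, `m² ≥ 0`),
uniformly in `n ≥ 1` — strengthening the slice statement `B4StripCauchy.differentiableAt_E_slice`. [folklore] -/
theorem differentiableAt_E (n : ℕ) [NeZero n] (a m2 : ℝ) (hm : 0 ≤ m2) {r : ℝ} (hr : r ≤ 1 / 4)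
    (hdr : (d : ℝ) * r ^ 2 ≤ 1 / 16) {q : Fin d → ℂ} (hq : q ∈ Fat d r) :
    DifferentiableAt ℂ (E n a m2) q := by
  have hne : ∀ k ∈ Finset.univ.erase (fun _ => (0 : Fin n)), DeltaXi n m2 (shift n k q) ≠ 0 := by
    intro k hk h
    have := re_DeltaXi_shift_ge n m2 hm hr hdr hq k (Finset.ne_of_mem_erase hk)
    rw [h, Complex.zero_re] at this
    linarith
  show DifferentiableAt ℂ (fun p => E n a m2 p) q
  simp only [E]
  apply DifferentiableAt.fun_add
  · apply DifferentiableAt.fun_add (differentiableAt_DeltaXi n m2 q)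
    exact (differentiableAt_U n hr hq _).const_mul _
  · apply DifferentiableAt.const_mul
    apply DifferentiableAt.fun_sum
    intro k hk
    exact (differentiableAt_U n hr hq k).fun_mul
      (dAt_div (differentiableAt_DeltaXi n m2 q) (differentiableAt_DeltaXi_shift n m2 k q) (hne k hk))

/-- **`𝒩` is holomorphic (jointly) at every point of the fat region** (`r ≤ 1/4`, `d r² ≤ 1/16`), uniformly in `n ≥ 1`.
[folklore] -/
theorem differentiableAt_Ncal (n : ℕ) [NeZero n] {r : ℝ} (hr : r ≤ 1 / 4)
    (hdr : (d : ℝ) * r ^ 2 ≤ 1 / 16) {q : Fin d → ℂ} (hq : q ∈ Fat d r) :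
    DifferentiableAt ℂ (Ncal n) q := by
  have hne : ∀ k ∈ Finset.univ.erase (fun _ => (0 : Fin n)), DeltaXi n 0 (shift n k q) ≠ 0 := by
    intro k hk h
    have := re_DeltaXi_shift_ge n 0 le_rfl hr hdr hq k (Finset.ne_of_mem_erase hk)
    rw [h, Complex.zero_re] at this
    linarith
  show DifferentiableAt ℂ (fun p => Ncal n p) q
  simp only [Ncal, Xne]
  apply DifferentiableAt.fun_add (differentiableAt_U n hr hq _)
  apply DifferentiableAt.fun_mul ((differentiableAt_DeltaXi n 0 q).pow 2)
  apply DifferentiableAt.fun_sum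
  intro k hk
  exact dAt_div (differentiableAt_U n hr hq k) ((differentiableAt_DeltaXi_shift n 0 k q).pow 2)
    (pow_ne_zero 2 (hne k hk))

/-- `mReg = 𝒩/E²` is holomorphic (jointly) at every point of the fat region where `E ≠ 0`. [folklore] -/
theorem differentiableAt_mReg (n : ℕ) [NeZero n] (a : ℝ) {r : ℝ} (hr : r ≤ 1 / 4)
    (hdr : (d : ℝ) * r ^ 2 ≤ 1 / 16) {q : Fin d → ℂ} (hq : q ∈ Fat d r) (hE : E n a 0 q ≠ 0) :
    DifferentiableAt ℂ (mReg n a) q := by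
  show DifferentiableAt ℂ (fun p => mReg n a p) q
  simp only [mReg]
  exact dAt_div (differentiableAt_Ncal n hr hdr hq) ((differentiableAt_E n a 0 le_rfl hr hdr hq).pow 2)
    (pow_ne_zero 2 hE)

/-- `1/mReg = E²/𝒩` (the multiplier of `(Q′G′²Q′*)⁻¹`) is holomorphic (jointly) at every point of the fat region where
`E ≠ 0` and `mReg ≠ 0`. [folklore] -/
theorem differentiableAt_mReg_inv (n : ℕ) [NeZero n] (a : ℝ) {r : ℝ} (hr : r ≤ 1 / 4)
    (hdr : (d : ℝ) * r ^ 2 ≤ 1 / 16) {q : Fin d → ℂ} (hq : q ∈ Fat d r) (hE : E n a 0 q ≠ 0)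
    (hm : mReg n a q ≠ 0) : DifferentiableAt ℂ (fun p => (mReg n a p)⁻¹) q :=
  (differentiableAt_mReg n a hr hdr hq hE).inv hm

/-- the coordinate-update map `w ↦ q[μ := w]` is holomorphic (affine). [folklore] -/
theorem differentiableAt_update (q : Fin d → ℂ) (μ : Fin d) (w : ℂ) :
    DifferentiableAt ℂ (fun z : ℂ => Function.update q μ z) w :=
  differentiableAt_pi.2 (fun ν => (differentiable_update_apply q μ ν) w)

/-- slice form for one-coordinate contour shifts: `w ↦ 1/mReg(q[μ := w])` is holomorphic at `q_μ`. [folklore] -/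
theorem differentiableAt_mReg_inv_slice (n : ℕ) [NeZero n] (a : ℝ) {r : ℝ} (hr : r ≤ 1 / 4)
    (hdr : (d : ℝ) * r ^ 2 ≤ 1 / 16) {q : Fin d → ℂ} (hq : q ∈ Fat d r) (hE : E n a 0 q ≠ 0)
    (hm : mReg n a q ≠ 0) (μ : Fin d) :
    DifferentiableAt ℂ (fun w => (mReg n a (Function.update q μ w))⁻¹) (q μ) := by
  have h := differentiableAt_mReg_inv n a hr hdr hq hE hm
  rw [← Function.update_eq_self μ q] at h
  exact h.comp (q μ) (differentiableAt_update q μ (q μ))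

/-! ### §5 The package consumed by a contour-shift engine -/

/-- strips are monotone in the half-width. [folklore] -/
theorem strip_mono {κ κ' : ℝ} (h : κ' ≤ κ) : Strip d κ' ⊆ Strip d κ :=
  fun _ hp μ => ⟨(hp μ).1, (hp μ).2.trans h⟩

/-- **THE ANALYTIC INPUTS FOR THE CONTOUR SHIFT OF `(Q′G′²Q′*)⁻¹` (B5 (1.45), p. 26; the decay (1.126)–(1.127),
p. 38).**  For `0 < a₋ ≤ a₊` there are `κ ∈ (0, r]` and `M > 0` such that for EVERY `n = L^k ≥ 1` and every
`a ∈ [a₋, a₊]` the inverse multiplier `G = 1/mReg = E²/𝒩` is, on `Strip d κ`: continuous (jointly), holomorphic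
(jointly, hence in every coordinate slice), `2π`-periodic across the strip sides (`G(p + 2π e_μ) = G(p)` when
`Re p_μ = −π`), and bounded by `M` — with `E ≠ 0`, `mReg ≠ 0` there.  (`κ`, `M` from `B5Strip145Leaves.uniformStrip145_holds`,
`κ` cut down to `≤ r`; `M = 1/c`.)  These are exactly the hypotheses under which shifting the `p′`-integration to
`p′ + iq`, `|q_μ| ≤ κ`, produces the factor `e^{−κ|y−y′|}`; the shift itself is not performed in this file. [folklore] -/
theorem inverse145_analytic_inputs (d : ℕ) (aminus aplus : ℝ) (ha : 0 < aminus) :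
    ∃ κ M : ℝ, 0 < κ ∧ κ ≤ rOf d ∧ 0 < M ∧ ∀ (n : ℕ) [NeZero n] (a : ℝ), aminus ≤ a → a ≤ aplus →
      (∀ p ∈ Strip d κ, E n a 0 p ≠ 0 ∧ mReg n a p ≠ 0) ∧
      ContinuousOn (fun p => (mReg n a p)⁻¹) (Strip d κ) ∧
      (∀ p ∈ Strip d κ, DifferentiableAt ℂ (fun q => (mReg n a q)⁻¹) p) ∧
      (∀ p ∈ Strip d κ, ∀ μ, (p μ).re = -Real.pi → (mReg n a (tr p μ))⁻¹ = (mReg n a p)⁻¹) ∧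
      (∀ p ∈ Strip d κ, ‖(mReg n a p)⁻¹‖ ≤ M) := by
  obtain ⟨κ₁, c, C, hκ₁, hc, h⟩ := uniformStrip145_holds d aminus aplus ha
  refine ⟨min κ₁ (rOf d), 1 / c, lt_min hκ₁ (rOf_pos d), min_le_right _ _, by positivity, ?_⟩
  intro n _ a ha1 ha2
  have hsub : Strip d (min κ₁ (rOf d)) ⊆ Strip d κ₁ := strip_mono (min_le_left _ _)
  have hκ0 : 0 ≤ min κ₁ (rOf d) := (lt_min hκ₁ (rOf_pos d)).le
  have hκr : min κ₁ (rOf d) ≤ rOf d := min_le_right _ _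
  obtain ⟨hκ1, hdκ⟩ := kappa_small hκ0 hκr
  have hfat : Strip d (min κ₁ (rOf d)) ⊆ Fat d (rOf d) := strip_subset_fat (rOf_pos d).le hκr
  have hnz : ∀ p ∈ Strip d (min κ₁ (rOf d)), E n a 0 p ≠ 0 ∧ mReg n a p ≠ 0 := by
    intro p hp
    obtain ⟨hE, hcle, _⟩ := h n a ha1 ha2 p (hsub hp)
    refine ⟨hE, fun hm => ?_⟩
    rw [hm, norm_zero] at hcle
    linarith
  have hdiff : ∀ p ∈ Strip d (min κ₁ (rOf d)), DifferentiableAt ℂ (fun q => (mReg n a q)⁻¹) p :=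
    fun p hp => differentiableAt_mReg_inv n a (rOf_le d) (d_mul_rOf_sq_le d) (hfat hp) (hnz p hp).1 (hnz p hp).2
  refine ⟨hnz, fun p hp => (hdiff p hp).continuousAt.continuousWithinAt, hdiff, ?_, ?_⟩
  · intro p hp μ hre
    rw [mReg_periodic_side n a hκ1 hdκ hp μ hre]
  · intro p hp
    obtain ⟨_, hcle, _⟩ := h n a ha1 ha2 p (hsub hp)
    rw [norm_inv]
    rw [one_div]
    exact inv_anti₀ hc hcle

end

end Literature.MathematicalPhysics.QuantumFieldTheory.Balaban1983to89.B5Strip145Analytic
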